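import Summits.NavierStokesRegularity.NavierStokesRegularity.Theorems.PerpetualPumpThesisBesovDuhamelBoundKern
import Summits.NavierStokesRegularity.NavierStokesRegularity.Theorems.PerpetualPumpThesisBesovDuhamelBoundTest
import Literature.Analysis.FluidPDE.TaoAveragedSlotMeasurable
import Literature.Analysis.FunctionSpaces.LittlewoodPaleyDifferenceProofs

/-!
# Stub `besovDuhamelBound` for `PerpetualPump.Thesis`, part IX: the Fourier transform of the
# rotated–dilated–smoothed test fields and the `L¹` bound of their derivatives

Support file (part 9 of the stub `besovDuhamelBound` of line `SketchIdeator2`, crux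
stmt-NavierStokesRegularity-1832). For an averaging datum `𝒜` (T. Tao, J. Amer. Math. Soc. 29 (2016),
(1.12)), the test field `w = w_{k,x,i}` of part VI (`ŵ(η) = e^{-2πi x·η} φ_k(η) P(η) e_i`) enters the
Duhamel term of the Besov–Duhamel estimate through `H = A₃(θ) e^{σΔ} w`,
`A₃ = m₃(D) Rot_R Dil_λ`. This file computes `ξ_j Ĥ_l(ξ)` (tree `fourierFn_slot_ae_eq`, `fourierFn_heat`):
after the substitution `ξ = 2ᵏλ ζ` it is `e^{-2πi v·ξ} · 2ᵏλ^{-1/2} · Θ_{jl}(ξ/(2ᵏλ))` with the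
Schwartz symbol `Θ_{jl}` of part V (`r = σ 4ᵏ`, same rotation `R`), so that
(`FA.exists_gamma`): **there are Schwartz functions `γ_{jl}`, a.e. equal to `ξ_j Ĥ_l`, with
`‖𝓕⁻¹γ_{jl}‖_{L¹} ≤ C (∑_{i≤n} ‖m₃‖_i) 2ᵏ e^{-π² σ 4ᵏ/8}`** — translation and dilation do not change
`‖𝓕⁻¹ ·‖_{L¹}`, and `λ^{-1/2} ≤ max(1, C_𝒜)`. Fed into the physical-space Euler bound of part IV
this is the key bilinear estimate `|⟨B̃(u,u), e^{σΔ} w_{k,x,i}⟩| ≲ ‖u‖²_{Ḃ⁰_{∞,1}} 2ᵏ e^{-cσ4ᵏ}`.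

## References

* T. Tao, J. Amer. Math. Soc. 29 (2016), 601–674, §1.1 (1.11)–(1.15).
* H. Bahouri, J.-Y. Chemin, R. Danchin, *Fourier Analysis and Nonlinear PDE* (2011), Lemma 2.4.
-/

noncomputable section

open MeasureTheory Filter Topology FourierTransform Real Complex
open scoped SchwartzMap ENNReal NNReal RealInnerProductSpace FourierTransform

set_option linter.dupNamespace false

namespace Summit.NavierStokesRegularity.NavierStokesRegularity.Theorems.PerpetualPumpThesis.FA

open Literature.Analysis.FunctionSpaces Literature.Analysis.FluidPDE
  Literature.Analysis.FluidPDE.Tao2016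

/-! ### Translation and dilation do not change `‖𝓕⁻¹ ·‖_{L¹}` -/

/-- `𝓕⁻¹[e^{-2πi⟪·,v⟫} Ψ](y) = 𝓕⁻¹Ψ(y - v)`: a phase on the Fourier side is a translation. -/
theorem fourierInv_smulLeftCLM_translSymbol_apply (v : EuclideanSpace ℝ (Fin 3))
    (Ψ : 𝓢(EuclideanSpace ℝ (Fin 3), ℂ)) (y : EuclideanSpace ℝ (Fin 3)) :
    (𝓕⁻ (SchwartzMap.smulLeftCLM ℂ (translSymbol (-v)) Ψ) : 𝓢(EuclideanSpace ℝ (Fin 3), ℂ)) y =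
      (𝓕⁻ Ψ : 𝓢(EuclideanSpace ℝ (Fin 3), ℂ)) (y - v) := by
  rw [SchwartzMap.fourierInv_coe, SchwartzMap.fourierInv_coe, Real.fourierInv_eq, Real.fourierInv_eq]
  refine integral_congr_ae (ae_of_all _ fun ξ => ?_)
  dsimp only
  rw [SchwartzMap.smulLeftCLM_apply_apply (hasTemperateGrowth_translSymbol (-v)), translSymbol_apply,
    Circle.smul_def, Circle.smul_def, smul_eq_mul, smul_eq_mul, smul_eq_mul, ← mul_assoc,
    ← Circle.coe_mul, ← AddChar.map_add_eq_mul, inner_sub_right, inner_neg_right]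
  ring_nf

/-- `‖𝓕⁻¹[e^{-2πi⟪·,v⟫} Ψ]‖_{L¹} = ‖𝓕⁻¹Ψ‖_{L¹}`. -/
theorem eLpNorm_fourierInv_smulLeftCLM_translSymbol (v : EuclideanSpace ℝ (Fin 3))
    (Ψ : 𝓢(EuclideanSpace ℝ (Fin 3), ℂ)) :
    eLpNorm (⇑(𝓕⁻ (SchwartzMap.smulLeftCLM ℂ (translSymbol (-v)) Ψ) : 𝓢(EuclideanSpace ℝ (Fin 3), ℂ)))
      1 volume = eLpNorm (⇑(𝓕⁻ Ψ : 𝓢(EuclideanSpace ℝ (Fin 3), ℂ))) 1 volume := by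
  have h : (⇑(𝓕⁻ (SchwartzMap.smulLeftCLM ℂ (translSymbol (-v)) Ψ) : 𝓢(EuclideanSpace ℝ (Fin 3), ℂ))) =
      (⇑(𝓕⁻ Ψ : 𝓢(EuclideanSpace ℝ (Fin 3), ℂ))) ∘ fun y => y - v :=
    funext fun y => fourierInv_smulLeftCLM_translSymbol_apply v Ψ y
  rw [h]
  exact eLpNorm_comp_measurePreserving
    (𝓕⁻ Ψ : 𝓢(EuclideanSpace ℝ (Fin 3), ℂ)).continuous.aestronglyMeasurable
    (measurePreserving_sub_right volume v)

/-- `‖𝓕⁻¹[Ψ(u ·)]‖_{L¹} = ‖𝓕⁻¹Ψ‖_{L¹}` (`𝓕⁻¹[Ψ(u·)] = |u|^{-d} 𝓕⁻¹Ψ(u⁻¹·)`, change of variables). -/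
theorem eLpNorm_fourierInv_compSmulLeft (u : ℝˣ) (Ψ : 𝓢(EuclideanSpace ℝ (Fin 3), ℂ)) :
    eLpNorm (⇑(𝓕⁻ (SchwartzMap.compCLMOfContinuousLinearEquiv ℂ
      (ContinuousLinearEquiv.smulLeft u : EuclideanSpace ℝ (Fin 3) ≃L[ℝ] EuclideanSpace ℝ (Fin 3)) Ψ) :
        𝓢(EuclideanSpace ℝ (Fin 3), ℂ))) 1 volume =
      eLpNorm (⇑(𝓕⁻ Ψ : 𝓢(EuclideanSpace ℝ (Fin 3), ℂ))) 1 volume := by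
  rw [fourierInv_compSmulLeft u Ψ]
  set S : 𝓢(EuclideanSpace ℝ (Fin 3), ℂ) := 𝓕⁻ Ψ with hS
  set c : ℂ := ((|((u : ℝ) ^ Module.finrank ℝ (EuclideanSpace ℝ (Fin 3)))⁻¹| : ℝ) : ℂ) with hc
  have hcoe : (⇑(c • SchwartzMap.compCLMOfContinuousLinearEquiv ℂ
      (ContinuousLinearEquiv.smulLeft u⁻¹ : EuclideanSpace ℝ (Fin 3) ≃L[ℝ] EuclideanSpace ℝ (Fin 3)) S) :
        EuclideanSpace ℝ (Fin 3) → ℂ) = c • fun x => S (((u⁻¹ : ℝˣ) : ℝ) • x) := by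
    funext x
    rfl
  rw [hcoe, eLpNorm_const_smul, eLpNorm_comp_smul 1 _ (u⁻¹).ne_zero, ← mul_assoc]
  have hone : ‖c‖ₑ * ENNReal.ofReal |((((u⁻¹ : ℝˣ) : ℝ)) ^ Module.finrank ℝ (EuclideanSpace ℝ (Fin 3)))⁻¹| ^
      (1 / (1 : ℝ≥0∞)).toReal = 1 := by
    rw [hc, ← ofReal_norm, Complex.norm_real, Real.norm_eq_abs, abs_abs]
    simp only [ENNReal.div_self one_ne_zero ENNReal.one_ne_top, ENNReal.toReal_one, ENNReal.rpow_one]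
    rw [← ENNReal.ofReal_mul (abs_nonneg _), mul_comm, abs_inv_pow_inv_mul_abs_pow_inv, ENNReal.ofReal_one]
  rw [hone, one_mul]

/-! ### The rescaled symbol: algebra -/

/-- `t^{1/2} ≤ max 1 t` for `t ≥ 0`. -/
theorem rpow_half_le_max (t : ℝ) (ht : 0 ≤ t) : t ^ ((1 : ℝ) / 2) ≤ max 1 t := by
  rcases le_or_gt t 1 with h | h
  · exact (Real.rpow_le_one ht h (by norm_num)).trans (le_max_left _ _)
  · calc t ^ ((1 : ℝ) / 2) ≤ t ^ (1 : ℝ) := Real.rpow_le_rpow_of_exponent_le h.le (by norm_num)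
      _ = t := Real.rpow_one t
      _ ≤ max 1 t := le_max_right _ _

/-- The constant `2ᵏλ · λ^{-3/2} = 2ᵏ λ^{-1/2}` is at most `2ᵏ max(1, C)` when `0 < C`, `C⁻¹ ≤ λ`. -/
theorem scale_const_le {lam C : ℝ} (hlam : 0 < lam) (hC0 : 0 < C) (hC : C⁻¹ ≤ lam) (k : ℤ) :
    (2 : ℝ) ^ k * lam * lam⁻¹ ^ ((3 : ℝ) / 2) ≤ (2 : ℝ) ^ k * max 1 C := by
  have hli : 0 < lam⁻¹ := inv_pos.2 hlam
  have h32 : lam⁻¹ ^ ((3 : ℝ) / 2) = lam⁻¹ * lam⁻¹ ^ ((1 : ℝ) / 2) := by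
    rw [show (3 : ℝ) / 2 = 1 + 1 / 2 by norm_num, Real.rpow_add hli, Real.rpow_one]
  rw [h32, mul_assoc, ← mul_assoc lam, mul_inv_cancel₀ hlam.ne', one_mul]
  refine mul_le_mul_of_nonneg_left ((rpow_half_le_max _ hli.le).trans (max_le_max le_rfl ?_))
    (zpow_nonneg zero_le_two _)
  rw [inv_le_comm₀ hlam hC0]
  exact hC

/-- `⟪x, R⁻¹ξ⟫ = ⟪Rx, ξ⟫` for a linear isometry equivalence. -/
theorem inner_symm_eq (R : EuclideanSpace ℝ (Fin 3) ≃ₗᵢ[ℝ] EuclideanSpace ℝ (Fin 3))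
    (x ξ : EuclideanSpace ℝ (Fin 3)) : ⟪x, R.symm ξ⟫ = ⟪R x, ξ⟫ := by
  conv_rhs => rw [← R.apply_symm_apply ξ]
  exact (R.inner_map_map x (R.symm ξ)).symm

/-- **The rescaled test symbol is `ξ_j Ĥ_l(ξ)`, pointwise.** With `a = 2ᵏλ`, `η = λ⁻¹R⁻¹ξ`:
`e^{-2πi⟪λ⁻¹Rx, ξ⟫} · aλ^{-3/2} · Θ_{jl}(ξ/a) = ξ_j [m(ξ) R_ℂ(λ^{-3/2} e^{-4π²σ|η|²} e^{-2πi x·η} φ_k(η) P(η)e_i)]_l`,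
where `Θ_{jl}(ζ) = ζ_j m(aζ) e^{-(2π)²σ4ᵏ|ζ|²} φ₀(R⁻¹ζ) (R_ℂ P(R⁻¹ζ)e_i)_l` (part V). -/
theorem gamma_pointwise (m : EuclideanSpace ℝ (Fin 3) → ℂ) {lam : ℝ} (hlam : 0 < lam)
    (R : EuclideanSpace ℝ (Fin 3) ≃ₗᵢ[ℝ] EuclideanSpace ℝ (Fin 3)) {σ : ℝ} (hσ : 0 ≤ σ)
    (k : ℤ) (x : EuclideanSpace ℝ (Fin 3)) (i j l : Fin 3) (ξ : EuclideanSpace ℝ (Fin 3)) :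
    ((((2 : ℝ) ^ k * lam : ℝ) : ℂ) * (((lam⁻¹ ^ ((3 : ℝ) / 2) : ℝ)) : ℂ)) *
      (translSymbol (-(lam⁻¹ • R x)) ξ *
        (EuclideanSpace.complexify ((((2 : ℝ) ^ k * lam)⁻¹) • ξ) j *
          m (((2 : ℝ) ^ k * lam) • ((((2 : ℝ) ^ k * lam)⁻¹) • ξ)) *
          ((Literature.Analysis.UnboundedOperators.heatSymbol (σ * ((2 : ℝ) ^ k) ^ 2)
            ((((2 : ℝ) ^ k * lam)⁻¹) • ξ) : ℝ) : ℂ) *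
          dyadicSymbol 0 (R.symm ((((2 : ℝ) ^ k * lam)⁻¹) • ξ)) *
          (complexifyCLM R.toLinearIsometry.toContinuousLinearMap
            (EuclideanSpace.single i (1 : ℂ) -
              (EuclideanSpace.complexify (R.symm ((((2 : ℝ) ^ k * lam)⁻¹) • ξ)) i /
                ((‖R.symm ((((2 : ℝ) ^ k * lam)⁻¹) • ξ)‖ ^ 2 : ℝ) : ℂ)) •
                EuclideanSpace.complexify (R.symm ((((2 : ℝ) ^ k * lam)⁻¹) • ξ)))) l)) =
    EuclideanSpace.complexify ξ j *
      ((m ξ) • complexifyCLM R.toLinearIsometry.toContinuousLinearMap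
        ((((lam⁻¹ ^ ((3 : ℝ) / 2) : ℝ)) : ℂ) •
          (heatSymbol σ (lam⁻¹ • R.symm ξ) •
            (((𝐞 (-⟪x, lam⁻¹ • R.symm ξ⟫) : ℂ) * dyadicSymbol k (lam⁻¹ • R.symm ξ)) •
              (EuclideanSpace.single i (1 : ℂ) -
                (EuclideanSpace.complexify (lam⁻¹ • R.symm ξ) i /
                  ((‖lam⁻¹ • R.symm ξ‖ ^ 2 : ℝ) : ℂ)) • EuclideanSpace.complexify (lam⁻¹ • R.symm ξ)))))) l := by
  set a : ℝ := (2 : ℝ) ^ k * lam with ha_def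
  have ha : 0 < a := mul_pos (zpow_pos two_pos _) hlam
  have hai : a⁻¹ = (2 : ℝ) ^ (-k) * lam⁻¹ := by rw [ha_def, mul_inv, zpow_neg]
  -- factor by factor
  have e2 : a • (a⁻¹ • ξ) = ξ := by rw [smul_smul, mul_inv_cancel₀ ha.ne', one_smul]
  have e3 : EuclideanSpace.complexify (a⁻¹ • ξ) j = ((a⁻¹ : ℝ) : ℂ) * EuclideanSpace.complexify ξ j := by
    rw [LinearIsometry.map_smul, PiLp.smul_apply, Complex.real_smul]
  have e4 : ((Literature.Analysis.UnboundedOperators.heatSymbol (σ * ((2 : ℝ) ^ k) ^ 2) (a⁻¹ • ξ) : ℝ) : ℂ) =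
      heatSymbol σ (lam⁻¹ • R.symm ξ) := by
    simp only [Literature.Analysis.UnboundedOperators.heatSymbol, heatSymbol, max_eq_left hσ]
    congr 1
    congr 1
    rw [norm_smul, norm_smul, R.symm.norm_map, Real.norm_of_nonneg (inv_nonneg.2 ha.le),
      Real.norm_of_nonneg (inv_nonneg.2 hlam.le), ha_def]
    field_simp
    ring
  have e5 : dyadicSymbol 0 (R.symm (a⁻¹ • ξ)) = dyadicSymbol k (lam⁻¹ • R.symm ξ) := by
    rw [dyadicSymbol_eq_dyadicSymbol_zero_smul k, LinearIsometryEquiv.map_smul, smul_smul, hai]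
  have e6 : EuclideanSpace.single i (1 : ℂ) -
      (EuclideanSpace.complexify (R.symm (a⁻¹ • ξ)) i / ((‖R.symm (a⁻¹ • ξ)‖ ^ 2 : ℝ) : ℂ)) •
        EuclideanSpace.complexify (R.symm (a⁻¹ • ξ)) =
      EuclideanSpace.single i (1 : ℂ) -
        (EuclideanSpace.complexify (R.symm ξ) i / ((‖R.symm ξ‖ ^ 2 : ℝ) : ℂ)) • EuclideanSpace.complexify (R.symm ξ) := by
    rw [LinearIsometryEquiv.map_smul]
    exact lerayVec_smul (inv_ne_zero ha.ne') _ _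
  have e7 : EuclideanSpace.single i (1 : ℂ) -
      (EuclideanSpace.complexify (lam⁻¹ • R.symm ξ) i / ((‖lam⁻¹ • R.symm ξ‖ ^ 2 : ℝ) : ℂ)) •
        EuclideanSpace.complexify (lam⁻¹ • R.symm ξ) =
      EuclideanSpace.single i (1 : ℂ) -
        (EuclideanSpace.complexify (R.symm ξ) i / ((‖R.symm ξ‖ ^ 2 : ℝ) : ℂ)) • EuclideanSpace.complexify (R.symm ξ) :=
    lerayVec_smul (inv_ne_zero hlam.ne') _ _
  have e8 : translSymbol (-(lam⁻¹ • R x)) ξ = (𝐞 (-⟪x, lam⁻¹ • R.symm ξ⟫) : ℂ) := by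
    rw [translSymbol_apply, inner_neg_right, real_inner_smul_right, real_inner_smul_right, inner_symm_eq,
      real_inner_comm]
  rw [e2, e3, e4, e5, e6, e7, e8]
  -- the nested scalars on the right
  simp only [map_smul, smul_smul, PiLp.smul_apply, smul_eq_mul]
  have ha' : ((a : ℝ) : ℂ) ≠ 0 := by exact_mod_cast ha.ne'
  have hinv : ((a⁻¹ : ℝ) : ℂ) = ((a : ℝ) : ℂ)⁻¹ := Complex.ofReal_inv a
  rw [hinv]
  field_simp

/-! ### The Schwartz functions `γ_{jl}` -/

/-- **The derivative symbols `ξ_j Ĥ_l` of the rotated–dilated–smoothed test fields are Schwartz,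
with `‖𝓕⁻¹γ_{jl}‖_{L¹} ≤ C (∑_{i≤n} ‖m₃‖_i) 2ᵏ e^{-π²σ4ᵏ/8}`.** For every averaging datum `𝒜` there
are `n`, `C` such that for all `θ`, `σ ≥ 0`, `k`, `x`, `i` and every `w ∈ L²(ℝ³; ℂ³)` with
`ŵ(η) = e^{-2πi x·η} φ_k(η) P(η) e_i` a.e., the field `H = A₃(θ) e^{σΔ} w` admits Schwartz functions
`γ_{jl}` (`j, l ∈ {0,1,2}`) with `γ_{jl}(ξ) = ξ_j Ĥ_l(ξ)` a.e. and
`‖𝓕⁻¹γ_{jl}‖_{L¹} ≤ C (∑_{i≤n} ‖m_{3,θ}‖_i) · 2ᵏ e^{-(π²/8) σ 4ᵏ}`. -/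
theorem exists_gamma (𝒜 : AveragingDatum) :
    ∃ (n : ℕ) (C : ℝ≥0), ∀ (θ : 𝒜.Ω) (σ : ℝ), 0 ≤ σ → ∀ (k : ℤ) (x : EuclideanSpace ℝ (Fin 3))
      (i : Fin 3) (w : L2C),
      (fourierFn w =ᵐ[volume] fun η : EuclideanSpace ℝ (Fin 3) =>
        ((𝐞 (-⟪x, η⟫) : ℂ) * dyadicSymbol k η) •
          (EuclideanSpace.single i (1 : ℂ) -
            (EuclideanSpace.complexify η i / ((‖η‖ ^ 2 : ℝ) : ℂ)) • EuclideanSpace.complexify η)) →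
      ∃ γ : Fin 3 → Fin 3 → 𝓢(EuclideanSpace ℝ (Fin 3), ℂ),
        (∀ j l, (⇑(γ j l) : EuclideanSpace ℝ (Fin 3) → ℂ) =ᵐ[volume]
          fun ξ => EuclideanSpace.complexify ξ j * fourierFn (𝒜.slot 2 θ (heat σ w)) ξ l) ∧
        ∀ j l, eLpNorm (⇑(𝓕⁻ (γ j l) : 𝓢(EuclideanSpace ℝ (Fin 3), ℂ))) 1 volume ≤
          C * ENNReal.ofReal (∑ i ∈ Finset.range (n + 1), (symbolSeminorm i (𝒜.m 2 θ)).toReal) *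
            ENNReal.ofReal ((2 : ℝ) ^ k * Real.exp (-(π ^ 2 / 8) * (σ * ((2 : ℝ) ^ k) ^ 2))) := by
  obtain ⟨n, CK, hK⟩ := exists_thetaKernel
  obtain ⟨CL, hCL⟩ := 𝒜.lam_bdd
  refine ⟨n, CK * (max 1 CL).toNNReal, fun θ σ hσ k x i w hw => ?_⟩
  have hlam : 0 < 𝒜.lam 2 θ := 𝒜.lam_pos 2 θ
  have hCL0 : 0 < CL := hlam.trans_le (hCL 2 θ).2
  set lam : ℝ := 𝒜.lam 2 θ with hlam_def
  set R : EuclideanSpace ℝ (Fin 3) ≃ₗᵢ[ℝ] EuclideanSpace ℝ (Fin 3) := 𝒜.R 2 θ with hR_def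
  set m : EuclideanSpace ℝ (Fin 3) → ℂ := 𝒜.m 2 θ with hm_def
  have hm : IsRealSymbol m := 𝒜.isRealSymbol 2 θ
  set a : ℝ := (2 : ℝ) ^ k * lam with ha_def
  have ha : 0 < a := mul_pos (zpow_pos two_pos _) hlam
  set r : ℝ := σ * ((2 : ℝ) ^ k) ^ 2 with hr_def
  have hr : 0 ≤ r := by positivity
  have hΘ := fun j l => hK m hm a ha r hr R i j l
  choose Θ hΘf hΘb using hΘ
  set aU : ℝˣ := Units.mk0 a⁻¹ (inv_ne_zero ha.ne') with haU
  set v : EuclideanSpace ℝ (Fin 3) := lam⁻¹ • R x with hv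
  set cst : ℂ := (((a : ℝ)) : ℂ) * (((lam⁻¹ ^ ((3 : ℝ) / 2) : ℝ)) : ℂ) with hcst
  set γ : Fin 3 → Fin 3 → 𝓢(EuclideanSpace ℝ (Fin 3), ℂ) := fun j l =>
    cst • SchwartzMap.smulLeftCLM ℂ (translSymbol (-v))
      (SchwartzMap.compCLMOfContinuousLinearEquiv ℂ
        (ContinuousLinearEquiv.smulLeft aU : EuclideanSpace ℝ (Fin 3) ≃L[ℝ] EuclideanSpace ℝ (Fin 3)) (Θ j l))
    with hγ
  refine ⟨γ, fun j l => ?_, fun j l => ?_⟩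
  · -- the a.e. formula
    have hslot := 𝒜.toComplex.fourierFn_slot_ae_eq 2 θ (heat σ w)
    have hhw : fourierFn (heat σ w) =ᵐ[volume] fun η : EuclideanSpace ℝ (Fin 3) =>
        heatSymbol σ η • (((𝐞 (-⟪x, η⟫) : ℂ) * dyadicSymbol k η) •
          (EuclideanSpace.single i (1 : ℂ) -
            (EuclideanSpace.complexify η i / ((‖η‖ ^ 2 : ℝ) : ℂ)) • EuclideanSpace.complexify η)) := by
      filter_upwards [fourierFn_heat σ w, hw] with η h1 h2
      rw [h1, h2]
    have hq : Measure.QuasiMeasurePreserving (fun ξ : EuclideanSpace ℝ (Fin 3) => lam⁻¹ • R.symm ξ) volume volume :=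
      (Measure.quasiMeasurePreserving_smul volume (inv_ne_zero hlam.ne')).comp
        R.symm.measurePreserving.quasiMeasurePreserving
    have hcomp := hq.ae_eq hhw
    have hz : ∀ᵐ ξ : EuclideanSpace ℝ (Fin 3), ξ ∈ ({0}ᶜ : Set (EuclideanSpace ℝ (Fin 3))) :=
      compl_mem_ae_iff.mpr (measure_singleton _)
    have htl : 𝒜.toComplex.lam 2 θ = lam := rfl
    have htR : 𝒜.toComplex.R 2 θ = R := rfl
    have htm : 𝒜.toComplex.m 2 θ = m := rfl
    filter_upwards [hslot, hcomp, hz] with ξ e1 e2 e3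
    simp only [Function.comp_apply] at e2
    rw [show 𝒜.slot 2 θ (heat σ w) = 𝒜.toComplex.slot 2 θ (heat σ w) from rfl, e1, htl, htR, htm,
      Set.indicator_of_mem e3, e2, hγ]
    dsimp only
    rw [smul_apply, smul_eq_mul, SchwartzMap.smulLeftCLM_apply_apply (hasTemperateGrowth_translSymbol _),
      compSmulLeft_apply, smul_eq_mul, hΘf j l, haU, Units.val_mk0]
    exact gamma_pointwise m hlam R hσ k x i j l ξ
  · -- the `L¹` bound
    have hcoe : (⇑(𝓕⁻ (γ j l) : 𝓢(EuclideanSpace ℝ (Fin 3), ℂ))) =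
        cst • (⇑(𝓕⁻ (SchwartzMap.smulLeftCLM ℂ (translSymbol (-v))
          (SchwartzMap.compCLMOfContinuousLinearEquiv ℂ
            (ContinuousLinearEquiv.smulLeft aU : EuclideanSpace ℝ (Fin 3) ≃L[ℝ] EuclideanSpace ℝ (Fin 3))
            (Θ j l))) : 𝓢(EuclideanSpace ℝ (Fin 3), ℂ))) := by
      rw [hγ]
      simp only
      rw [fourierInv_smul]
      rfl
    have hcst : ‖cst‖ₑ ≤ ENNReal.ofReal ((2 : ℝ) ^ k * max 1 CL) := by
      rw [hcst, ← ofReal_norm, norm_mul, Complex.norm_real, Complex.norm_real,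
        Real.norm_of_nonneg ha.le, Real.norm_of_nonneg (Real.rpow_nonneg (inv_nonneg.2 hlam.le) _)]
      exact ENNReal.ofReal_le_ofReal (scale_const_le hlam hCL0 (hCL 2 θ).1 k)
    set S : ℝ := ∑ i ∈ Finset.range (n + 1), (symbolSeminorm i m).toReal with hS
    calc eLpNorm (⇑(𝓕⁻ (γ j l) : 𝓢(EuclideanSpace ℝ (Fin 3), ℂ))) 1 volume
        = ‖cst‖ₑ * eLpNorm (⇑(𝓕⁻ (Θ j l) : 𝓢(EuclideanSpace ℝ (Fin 3), ℂ))) 1 volume := by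
          rw [hcoe, eLpNorm_const_smul, eLpNorm_fourierInv_smulLeftCLM_translSymbol,
            eLpNorm_fourierInv_compSmulLeft]
      _ ≤ ENNReal.ofReal ((2 : ℝ) ^ k * max 1 CL) *
            (CK * ENNReal.ofReal S * ENNReal.ofReal (Real.exp (-(π ^ 2 / 8) * r))) :=
          mul_le_mul' hcst (hΘb j l)
      _ = ((CK * (max 1 CL).toNNReal : ℝ≥0) : ℝ≥0∞) * ENNReal.ofReal S *
            ENNReal.ofReal ((2 : ℝ) ^ k * Real.exp (-(π ^ 2 / 8) * r)) := by
          rw [ENNReal.ofReal_mul (zpow_nonneg zero_le_two _), ENNReal.ofReal_mul (zpow_nonneg zero_le_two _),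
            ENNReal.coe_mul]
          have hmax : ((max 1 CL).toNNReal : ℝ≥0∞) = ENNReal.ofReal (max 1 CL) := rfl
          rw [hmax]
          ring

end Summit.NavierStokesRegularity.NavierStokesRegularity.Theorems.PerpetualPumpThesis.FA

namespace Summit.NavierStokesRegularity.NavierStokesRegularity.Theorems.PerpetualPumpThesis

open Literature.Analysis.FluidPDE Literature.Analysis.FluidPDE.Tao2016
open Literature.Analysis.FunctionSpaces

/-- **Part Gamma of stub `besovDuhamelBound` (registered sub-goal `stub_FA_Gamma`)**: for the test
fields `w` with `ŵ(η) = e^{-2πi x·η} φ_k(η) P(η) e_i`, the derivative symbols `ξ_j Ĥ_l` of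
`H = A₃(θ) e^{σΔ} w` are Schwartz functions `γ_{jl}` with
`‖𝓕⁻¹γ_{jl}‖_{L¹} ≤ C (∑_{i≤n} ‖m_{3,θ}‖_i) 2ᵏ e^{-(π²/8) σ 4ᵏ}` — the kernel side of the key bilinear
estimate of the Besov–Duhamel bound. -/
theorem stub_FA_Gamma : ∀ 𝒜 : AveragingDatum, ∃ (n : ℕ) (C : NNReal), ∀ (θ : 𝒜.Ω) (σ : ℝ), 0 ≤ σ → ∀ (k : ℤ) (x : EuclideanSpace ℝ (Fin 3)) (i : Fin 3) (w : L2C), (fourierFn w =ᵐ[volume] fun η : EuclideanSpace ℝ (Fin 3) => (((Real.fourierChar (-(inner ℝ x η)) : Circle) : ℂ) * dyadicSymbol k η) • (EuclideanSpace.single i (1 : ℂ) - (EuclideanSpace.complexify η i / ((‖η‖ ^ 2 : ℝ) : ℂ)) • EuclideanSpace.complexify η)) → ∃ γ : Fin 3 → Fin 3 → 𝓢(EuclideanSpace ℝ (Fin 3), ℂ), (∀ j l, (⇑(γ j l) : EuclideanSpace ℝ (Fin 3) → ℂ) =ᵐ[volume] fun ξ => EuclideanSpace.complexify ξ j * fourierFn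 (𝒜.slot 2 θ (heat σ w)) ξ l) ∧ ∀ j l, eLpNorm (⇑(FourierTransformInv.fourierInv (γ j l) : 𝓢(EuclideanSpace ℝ (Fin 3), ℂ))) 1 volume ≤ (C : ENNReal) * ENNReal.ofReal (∑ i ∈ Finset.range (n + 1), (symbolSeminorm i (𝒜.m 2 θ)).toReal) * ENNReal.ofReal ((2 : ℝ) ^ k * Real.exp (-(Real.pi ^ 2 / 8) * (σ * ((2 : ℝ) ^ k) ^ 2))) :=
  fun 𝒜 => FA.exists_gamma 𝒜

end Summit.NavierStokesRegularity.NavierStokesRegularity.Theorems.PerpetualPumpThesis
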